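import Literature.Combinatorics.Optimization.SeparatingFunctionalPsdRank
import HarnessLib

/-!
# Density matrix approximation against a single test (Lee–Raghavendra–Steurer 2015, Thm 3.4 = Thm 4.1), typed

Ninth file of the tree's Lee–Raghavendra–Steurer story, companion of
`SeparatingFunctionalPsdRank.lean` (LRS §3: the separating functional `L_D`, the named facts
Thm 3.1 / 3.3 / 3.5 and the derivation Thm 3.8 ⇐ Thm 3.1).  The printed proof of the main technical
theorem Thm 3.1 (p. 15–16) has three ingredients: psd factorisation scaling (Thm 3.3), degree
reduction (Thm 3.5) and the "central theme" of LRS §4 — **high-entropy density matrices are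
approximately minimised, against a single linear test `F`, by the square of a low-degree polynomial in
`F`** (Thm 3.4, restated and proved in §4.1 as Thm 4.1 via the Gibbs variational principle, Lemma 4.2,
and polynomial approximation of the matrix exponential, Lemma 4.3 / Cor 4.4).  This file TYPES that
third ingredient with the (small) density-operator vocabulary of LRS §2.1:

* `IsDensityMatrix Q` — "density operators … positive semidefinite operators with trace one" (p. 10);
* `vonNeumannEntropy X = −Tr(X log X)`, `relEntropy X Y = Tr(X (log X − log Y))` (p. 10), the matrix
  logarithm being Mathlib's continuous functional calculus `cfc Real.log` of a symmetric matrix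
  (spectral calculus; on psd matrices with kernel this is the standard `0 log 0 = 0` convention under
  which `S(X)` and `S(X‖𝕀)` are finite; LRS define `log` by its Taylor series on positive operators,
  which agrees on positive definite `X`);
* PROVED API: `relEntropy_self`, `isDensityMatrix_uniformDensity`, and
  `relEntropy_uniformDensity : S(X‖𝕀) = log r − S(X)` for `Tr X = 1`;
* NAMED FACT `LeeRaghavendraSteurer2015_thm34` — Thm 3.4 verbatim up to the rendering decisions:
  "`k ≲ (1 + S(Q‖𝕀))·‖F‖/ε`" is "`k ≤ C (1 + S(Q‖𝕀)) τ/ε` for a universal `C`" (LRS p. 10: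
  "`A ≲ B` denotes `A ≤ O(B)` … there exists a universal constant `C` such that `A ≤ C·B`") with the
  operator norm entering through any `τ` with `−τ·Id ⪯ F ⪯ τ·Id` (for symmetric `F`, `‖F‖ ≤ τ` iff
  this holds; larger `τ` weakens the conclusion); "degree-`k` polynomial `p`" is
  `p : Polynomial ℝ` with `natDegree p ≤ k`, `p(F)` is `Polynomial.aeval F p`, and the density matrix
  `Q̃ = p(F)²/Tr p(F)²` is written out with its (implicit in print) side condition `Tr p(F)² ≠ 0`.

NOT here: Thm 4.1's sharper form `k ≤ O(‖F‖/ε)·S(Q‖U) + O(log(1/ε)/log log(1/ε))` (asymptotic in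
`ε → 0`), Lemma 4.2 (Gibbs variational principle, cited there from [MR2681769]), Lemma 4.3, Cor 4.4,
§4.2 (Thm 4.5–4.8, approximation against families of tests), and any proof.

Source: J. R. Lee, P. Raghavendra, D. Steurer, STOC 2015 [LeeRaghavendraSteurer2015]; held text
`paper:arxiv-1411.6317`: §2.1 "Quantum information theory" (p. 10), Thm 3.4 (p. 15), §4.1 Thm 4.1,
Lemmas 4.2–4.3, Cor 4.4 (p. 18–19).
-/

noncomputable section

open Finset Matrix
open scoped MatrixOrder

namespace Literature.Combinatorics.Optimization

/-! ### Density operators and quantum (relative) entropy -/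

/-- A **density matrix**: positive semidefinite with trace one ("`𝒟(H)` … the set of density
operators on `H`, i.e., those positive semidefinite operators with trace one").
[cite: LeeRaghavendraSteurer2015, §2.1 (p. 10)] -/
def IsDensityMatrix {r : ℕ} (Q : Matrix (Fin r) (Fin r) ℝ) : Prop := Q.PosSemidef ∧ Q.trace = 1

/-- The **von Neumann entropy** `S(X) = −Tr(X log X)` (matrix logarithm by the functional calculus
of the symmetric matrix `X`, with `0 log 0 = 0`). [cite: LeeRaghavendraSteurer2015, §2.1 (p. 10: "S(X) = −Tr(X log X)")] -/
def vonNeumannEntropy {r : ℕ} (X : Matrix (Fin r) (Fin r) ℝ) : ℝ := -(X * cfc Real.log X).trace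

/-- The **quantum relative entropy** `S(X‖Y) = Tr(X·(log X − log Y))`.
[cite: LeeRaghavendraSteurer2015, §2.1 (p. 10: "S(X‖Y) = Tr(X·(log X − log Y))")] -/
def relEntropy {r : ℕ} (X Y : Matrix (Fin r) (Fin r) ℝ) : ℝ :=
  (X * (cfc Real.log X - cfc Real.log Y)).trace

/-- `S(X‖X) = 0`. [cite: LeeRaghavendraSteurer2015, §2.1 (p. 10)] -/
theorem relEntropy_self {r : ℕ} (X : Matrix (Fin r) (Fin r) ℝ) : relEntropy X X = 0 := by
  simp [relEntropy]

/-- The uniform density matrix `𝕀 = Id/Tr(Id)` is a density matrix (dimension `r ≥ 1`).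
[cite: LeeRaghavendraSteurer2015, §2.1 (p. 10: "𝕀 = Id/Tr(Id) … the uniform density matrix (i.e., the maximally mixed state)")] -/
theorem isDensityMatrix_uniformDensity {r : ℕ} (hr : 0 < r) : IsDensityMatrix (uniformDensity r) := by
  have hr' : (0 : ℝ) < r := by exact_mod_cast hr
  refine ⟨?_, ?_⟩
  · unfold uniformDensity
    exact PosSemidef.one.smul (by positivity)
  · unfold uniformDensity
    rw [trace_smul, trace_one, Fintype.card_fin, smul_eq_mul]
    field_simp

/-- The logarithm of the uniform density matrix is the scalar `log(1/r)`. [cite: LeeRaghavendraSteurer2015, §2.1 (p. 10)] -/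
theorem cfc_log_uniformDensity (r : ℕ) :
    cfc Real.log (uniformDensity r) = Real.log (1 / (r : ℝ)) • (1 : Matrix (Fin r) (Fin r) ℝ) := by
  unfold uniformDensity
  rw [show ((1 / (r : ℝ)) • (1 : Matrix (Fin r) (Fin r) ℝ)) = algebraMap ℝ _ (1 / (r : ℝ)) from
    (Algebra.algebraMap_eq_smul_one _).symm, cfc_algebraMap, Algebra.algebraMap_eq_smul_one]

/-- **`S(X‖𝕀) = log r − S(X)`** for `Tr X = 1` (the relative entropy to the maximally mixed state is
the entropy deficit). [cite: LeeRaghavendraSteurer2015, §2.1 (p. 10) and §3.1 (p. 15, eq. (entropy-deficit))] -/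
theorem relEntropy_uniformDensity {r : ℕ} (hr : 0 < r) {X : Matrix (Fin r) (Fin r) ℝ}
    (hX : X.trace = 1) : relEntropy X (uniformDensity r) = Real.log r - vonNeumannEntropy X := by
  have hr' : (0 : ℝ) < r := by exact_mod_cast hr
  rw [relEntropy, vonNeumannEntropy, cfc_log_uniformDensity, Matrix.mul_sub, trace_sub,
    Matrix.mul_smul, Matrix.mul_one, trace_smul, hX, smul_eq_mul, mul_one, one_div,
    Real.log_inv]
  ring

/-! ### The named fact -/

/-- **Lee–Raghavendra–Steurer 2015, Theorem 3.4 (Density matrix approximation; = Thm 4.1).**  "Let `H`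
be some finite-dimensional real inner-product space.  Let `F ∈ 𝓜(H)` be a symmetric matrix and let
`Q ∈ 𝒟(H)` be a density matrix.  Then, for every `ε > 0`, there exists a degree-`k` univariate
polynomial `p` with `k ≲ (1 + S(Q‖𝕀))·‖F‖/ε` such that the density matrix `Q̃ = p(F)²/Tr p(F)²`
satisfies `Tr(F Q̃) ≤ Tr(F Q) + ε`."  Rendered (module docstring): `H = ℝ^r` with its standard basis,
`≲` = "`≤ C ·`" for a universal `C > 0`, `‖F‖` through any `τ` with `−τ Id ⪯ F ⪯ τ Id`, and the side
condition `Tr p(F)² ≠ 0` of "the density matrix `Q̃`" made explicit.  NOT proved here (printed proof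
= Thm 4.1, §4.1: Lemma 4.2 + Lemma 4.3 + Cor 4.4). [cite: LeeRaghavendraSteurer2015, Thm. 3.4 (p. 15) (= Thm. 4.1, p. 18)] -/
def LeeRaghavendraSteurer2015_thm34 : Prop :=
  ∃ C : ℝ, 0 < C ∧
    ∀ (r : ℕ) (F Q : Matrix (Fin r) (Fin r) ℝ), F.IsSymm → IsDensityMatrix Q →
    ∀ τ : ℝ, -(τ • (1 : Matrix (Fin r) (Fin r) ℝ)) ≤ F → F ≤ τ • (1 : Matrix (Fin r) (Fin r) ℝ) →
    ∀ ε : ℝ, 0 < ε →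
    ∃ (k : ℕ) (p : Polynomial ℝ),
      (k : ℝ) ≤ C * (1 + relEntropy Q (uniformDensity r)) * τ / ε ∧ p.natDegree ≤ k ∧
      (Polynomial.aeval F p * Polynomial.aeval F p).trace ≠ 0 ∧
      (F * (Polynomial.aeval F p * Polynomial.aeval F p)).trace /
          (Polynomial.aeval F p * Polynomial.aeval F p).trace ≤ (F * Q).trace + ε

end Literature.Combinatorics.Optimization

end
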